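import Summits.CriticalPhenomena.SAWScalingLimit.Theorems.SAWDefectDecoherenceBoundaryClosureRPhaseSlit
import Summits.CriticalPhenomena.SAWScalingLimit.Theorems.SAWDefectDecoherenceBoundaryClosureRPhaseCornerGeometry
import HarnessLib

/-!
# Crux `BoundaryClosureR` (stmt-CriticalPhenomena-14004), line `polygon-parity-squeeze`,
# stub `boundaryPhaseBookkeeping` (piece D): the boundary of an exact polygon off the root

For an exact polygon family `ExactPolygonFamily D Λ` with a conformal frame:

* `isPreconnected_frontier_diff_root` — `∂Ω ∖ {a}` is preconnected (the image of an open period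
  interval under the boundary loop);
* `classify` — every point of `∂Ω ∖ {a}` is either a FLAT point carrying the full hypothesis block
  of `K2c` (half-plane ball, exact half-lattice eventually, root outside), or lies in the ball of
  a GENUINE corner carrying the full hypothesis block of `K4` (the degenerate presentations of
  `IsCornerAt` are: equal normals — a flat point; opposite normals, convex — empty, impossible at a
  closure point; opposite normals, reflex — a slit, impossible by `PhaseChart.slit_false`);
* `exists_flat_near` — flat points of `∂Ω ∖ {a}` are dense in it;
* `exists_boundaryValue` — at a flat point of `∂Ω ∖ {a}`, `im L` has a boundary value.

All statements are folklore.
-/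

noncomputable section

open scoped Topology ComplexConjugate
open Filter Set Metric Complex
open UpperHalfPlane (upperHalfPlaneSet)
open Literature.Probability.LatticeModels Literature.Probability.RandomPlanarGeometry
open Summit.CriticalPhenomena.SAWScalingLimit.Theorems.PickHalfPlane

namespace Summit.CriticalPhenomena.SAWScalingLimit.Theorems.PolygonParitySqueeze

namespace PhaseBook

/-! ### 1. `∂Ω ∖ {a}` is preconnected -/

/-- **The boundary of a Dobrushin domain minus the root is preconnected**: it is the image of the
open period interval `(m₀, m₀ + 1)` under the boundary loop (`m₀` the parameter of the root).
[folklore] -/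
theorem isPreconnected_frontier_diff_root (D : DobrushinDomain) :
    IsPreconnected (frontier D.carrier \ {D.pt 0}) := by
  set t₀ : ℝ := D.mark 0 with ht₀
  have ht₀m : t₀ ∈ Ico (0 : ℝ) 1 := D.mark_mem 0
  have hpt : D.pt 0 = D.boundary t₀ := rfl
  have heq : frontier D.carrier \ {D.pt 0} = D.boundary '' Ioo t₀ (t₀ + 1) := by
    apply Subset.antisymm
    · rintro x ⟨hx, hx0⟩
      rw [← D.range_boundary] at hx
      obtain ⟨t, rfl⟩ := hx
      obtain ⟨y, hy, hyx⟩ := D.periodic_boundary.exists_mem_Ico one_pos t t₀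
      refine ⟨y, ⟨lt_of_le_of_ne hy.1 fun h => hx0 ?_, hy.2⟩, hyx.symm⟩
      rw [mem_singleton_iff, hyx, ← h, hpt]
    · rintro _ ⟨t, ⟨ht1, ht2⟩, rfl⟩
      refine ⟨D.boundary_mem_frontier t, fun h => ?_⟩
      rw [mem_singleton_iff, hpt] at h
      rcases lt_or_ge t 1 with hlt | hge
      · have : t = t₀ := D.injOn_boundary ⟨ht₀m.1.trans ht1.le, hlt⟩ ht₀m h
        exact absurd this (ne_of_gt ht1)
      · have h' : D.boundary (t - 1) = D.boundary t₀ := by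
          rw [← h, ← D.periodic_boundary (t - 1), sub_add_cancel]
        have : t - 1 = t₀ := D.injOn_boundary ⟨by linarith, by linarith [ht₀m.2]⟩ ht₀m h'
        linarith
  rw [heq]
  exact isPreconnected_Ioo.image _ D.continuous_boundary.continuousOn

/-! ### 2. Classification of the boundary points off the root -/

/-- A ball of radius `< dist p q` about `p`, closed, misses `q`. [folklore] -/
theorem not_mem_closedBall_of_lt {p q : ℂ} {s : ℝ} (h : s < dist p q) : q ∉ closedBall p s :=
  fun h' => not_le.2 h (by rw [dist_comm]; exact mem_closedBall.1 h')

/-- **Classification of the points of `∂Ω ∖ {a}` of an exact polygon with a conformal frame**: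
flat points (hypothesis block of `K2c`) or points of genuine corner balls (hypothesis block of
`K4`). [folklore] -/
theorem classify (D : DobrushinDomain) (Λ : ℝ → Finset HexVertex) (hEx : ExactPolygonFamily D Λ)
    (Φ : ConformalEquiv D.carrier upperHalfPlaneSet)
    (hΦ0 : Tendsto (fun z => ‖Φ z‖) (𝓝[D.carrier] (D.pt 0)) atTop)
    {p : ℂ} (hp : p ∈ frontier D.carrier) (hp0 : p ≠ D.pt 0) :
    (∃ (k : Fin 6) (s : ℝ), 0 < s ∧ D.carrier ∩ ball p s = halfPlane k p ∩ ball p s ∧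
        (∀ᶠ δ : ℝ in 𝓝[>] 0, ∃ nthr : ℤ, ∀ v : HexVertex, (δ : ℂ) * hexCenter v ∈ ball p s →
          (v ∈ Λ δ ↔ nthr ≤ zigzagForm k v)) ∧ D.pt 0 ∉ closedBall p s) ∨
    (∃ (c : ℂ) (k k' : Fin 6) (s : ℝ), c ∈ frontier D.carrier ∧ 0 < s ∧
        innerNormal k' ≠ innerNormal k ∧ innerNormal k' ≠ -innerNormal k ∧
        (D.carrier ∩ ball c s = halfPlane k c ∩ halfPlane k' c ∩ ball c s ∨
          D.carrier ∩ ball c s = (halfPlane k c ∪ halfPlane k' c) ∩ ball c s) ∧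
        (∀ᶠ δ : ℝ in 𝓝[>] 0, ∃ nk nk' : ℤ,
          (∀ v : HexVertex, (δ : ℂ) * hexCenter v ∈ ball c s →
            (v ∈ Λ δ ↔ (nk ≤ zigzagForm k v ∧ nk' ≤ zigzagForm k' v))) ∨
          (∀ v : HexVertex, (δ : ℂ) * hexCenter v ∈ ball c s →
            (v ∈ Λ δ ↔ (nk ≤ zigzagForm k v ∨ nk' ≤ zigzagForm k' v)))) ∧
        D.pt 0 ∉ closedBall c s ∧ p ∈ ball c s) := by
  have hU : IsOpen D.carrier := D.isOpen
  obtain ⟨corners, r, hr, hcf, hdist, hev⟩ := hEx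
  obtain ⟨δ₀, hδ₀⟩ := hev.exists
  have hdp : 0 < dist p (D.pt 0) := dist_pos.2 hp0
  by_cases hfar : ∀ c ∈ corners, r ≤ dist p c
  · -- a flat side point of the family
    obtain ⟨k₀, n₀, hset₀, -⟩ := ((hδ₀ p hp).1 hfar)
    left
    set s : ℝ := min (r / 2) (dist p (D.pt 0) / 2) with hs
    have hs0 : 0 < s := lt_min (half_pos hr) (half_pos hdp)
    have hsub : ball p s ⊆ ball p (r / 2) := ball_subset_ball (min_le_left _ _)
    refine ⟨k₀, s, hs0, PhaseGeometry.inter_eq_inter_of_subset_ball hset₀ hsub, ?_,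
      not_mem_closedBall_of_lt (by rw [hs]; linarith [min_le_right (r / 2) (dist p (D.pt 0) / 2)])⟩
    filter_upwards [hev] with δ hδ
    obtain ⟨k₂, n₂, hset₂, hlat₂⟩ := (hδ p hp).1 hfar
    have hk : k₂ = k₀ := PhaseGeometry.form_unique (half_pos hr) (hset₂.symm.trans hset₀)
    subst hk
    exact ⟨n₂, fun v hv => hlat₂ v (hsub hv)⟩
  · push Not at hfar
    obtain ⟨c, hc, hpc⟩ := hfar
    have hcfr : c ∈ frontier D.carrier := hcf hc
    have hccl : c ∈ closure D.carrier := frontier_subset_closure hcfr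
    obtain ⟨k, k', n, n', hck⟩ := (hδ₀ c hcfr).2 hc
    have hsetc : D.carrier ∩ ball c r = halfPlane k c ∩ halfPlane k' c ∩ ball c r ∨
        D.carrier ∩ ball c r = (halfPlane k c ∪ halfPlane k' c) ∩ ball c r :=
      hck.imp And.left And.left
    have h0c : D.pt 0 ∉ ball c r := fun h => not_lt.2 (hdist 0 c hc) (mem_ball.1 h)
    have hpball : p ∈ ball c r := mem_ball.2 hpc
    by_cases heq : innerNormal k' = innerNormal k
    · -- equal normals: a flat point of form `k`
      have hflat : D.carrier ∩ ball c r = halfPlane k c ∩ ball c r := by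
        rcases hsetc with h | h
        · rw [h, PhaseGeometry.halfPlane_congr heq, inter_self]
        · rw [h, PhaseGeometry.halfPlane_congr heq, union_self]
      have hkk : k' = k := PhaseGeometry.innerNormal_injective heq
      have hlev : ((p - c) * conj (innerNormal k)).re = 0 :=
        PhaseGeometry.level_eq_zero_of_mem_frontier hU hflat hp hpball
      left
      have hgap : 0 < r - dist p c := by linarith
      set s : ℝ := min (r - dist p c) (dist p (D.pt 0) / 2) with hs
      have hs0 : 0 < s := lt_min hgap (half_pos hdp)
      have hsub : ball p s ⊆ ball c r := by
        intro w hw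
        rw [mem_ball] at hw ⊢
        have := min_le_left (r - dist p c) (dist p (D.pt 0) / 2)
        linarith [dist_triangle w p c]
      refine ⟨k, s, hs0, PhaseGeometry.flat_of_subset hflat hsub hlev, ?_,
        not_mem_closedBall_of_lt (by rw [hs]; linarith [min_le_right (r - dist p c) (dist p (D.pt 0) / 2)])⟩
      filter_upwards [hev] with δ hδ
      obtain ⟨k₂, k₂', n₂, n₂', hck₂⟩ := (hδ c hcfr).2 hc
      obtain ⟨e1, e2⟩ := PhaseGeometry.corner_forms_of_flat hr hflat (hck₂.imp And.left And.left)
      subst e1 e2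
      rcases hck₂ with ⟨-, hl⟩ | ⟨-, hl⟩
      · exact ⟨max n₂ n₂', fun v hv => by rw [hl v (hsub hv), max_le_iff]⟩
      · exact ⟨min n₂ n₂', fun v hv => by rw [hl v (hsub hv), min_le_iff]⟩
    · by_cases hneg : innerNormal k' = -innerNormal k
      · -- opposite normals: empty or slit, both impossible
        exfalso
        rcases hck with ⟨h, -⟩ | ⟨h, -⟩
        · rw [PhaseGeometry.inter_opp_eq_empty hneg, empty_inter] at h
          obtain ⟨w, hw⟩ := mem_closure_iff_nhds.1 hccl (ball c r) (isOpen_ball.mem_nhds (mem_ball_self hr))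
          have : w ∈ D.carrier ∩ ball c r := ⟨hw.2, hw.1⟩
          rw [h] at this
          exact this
        · rw [PhaseGeometry.union_opp_eq hneg] at h
          exact PhaseChart.slit_false D Φ hΦ0 (norm_innerNormal k) hr h h0c
      · -- a genuine corner
        right
        set s : ℝ := (dist p c + r) / 2 with hs
        have hs0 : 0 < s := by rw [hs]; linarith [dist_nonneg (x := p) (y := c)]
        have hsr : s < r := by rw [hs]; linarith
        have hps : dist p c < s := by rw [hs]; linarith
        have hsub : ball c s ⊆ ball c r := ball_subset_ball hsr.le
        refine ⟨c, k, k', s, hcfr, hs0, heq, hneg, ?_, ?_, ?_, mem_ball.2 hps⟩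
        · exact hsetc.imp (fun h => PhaseGeometry.inter_eq_inter_of_subset_ball h hsub)
            (fun h => PhaseGeometry.inter_eq_inter_of_subset_ball h hsub)
        · filter_upwards [hev] with δ hδ
          obtain ⟨k₂, k₂', n₂, n₂', hck₂⟩ := (hδ c hcfr).2 hc
          rcases PhaseGeometry.corner_forms_unique hr heq hneg hsetc (hck₂.imp And.left And.left) with
            ⟨e1, e2⟩ | ⟨e1, e2⟩
          · subst e1 e2
            rcases hck₂ with ⟨-, hl⟩ | ⟨-, hl⟩
            · exact ⟨n₂, n₂', Or.inl fun v hv => hl v (hsub hv)⟩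
            · exact ⟨n₂, n₂', Or.inr fun v hv => hl v (hsub hv)⟩
          · subst e1 e2
            rcases hck₂ with ⟨-, hl⟩ | ⟨-, hl⟩
            · exact ⟨n₂', n₂, Or.inl fun v hv => by rw [hl v (hsub hv), and_comm]⟩
            · exact ⟨n₂', n₂, Or.inr fun v hv => by rw [hl v (hsub hv), or_comm]⟩
        · intro h
          have h1 := mem_closedBall.1 h
          have h2 := hdist 0 c hc
          linarith

/-! ### 3. Flat points are dense; boundary values exist at flat points -/

/-- **Flat points are dense in `∂Ω ∖ {a}`.** [folklore] -/
theorem exists_flat_near (D : DobrushinDomain) (Λ : ℝ → Finset HexVertex)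
    (hEx : ExactPolygonFamily D Λ) (Φ : ConformalEquiv D.carrier upperHalfPlaneSet)
    (hΦ0 : Tendsto (fun z => ‖Φ z‖) (𝓝[D.carrier] (D.pt 0)) atTop)
    {p : ℂ} (hp : p ∈ frontier D.carrier) (hp0 : p ≠ D.pt 0) {t : ℝ} (ht : 0 < t) :
    ∃ q ∈ frontier D.carrier ∩ ball p t, q ≠ D.pt 0 ∧
      ∃ (k : Fin 6) (s : ℝ), 0 < s ∧ D.carrier ∩ ball q s = halfPlane k q ∩ ball q s := by
  have hU : IsOpen D.carrier := D.isOpen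
  rcases classify D Λ hEx Φ hΦ0 hp hp0 with ⟨k, s, hs, hflat, -, -⟩ |
    ⟨c, k, k', s, hcfr, hs, hk, hk', hset, -, h0, hpc⟩
  · exact ⟨p, ⟨hp, mem_ball_self ht⟩, hp0, k, s, hs, hflat⟩
  · have h0' : ∀ q ∈ ball c s, q ≠ D.pt 0 := fun q hq h => h0 (h ▸ ball_subset_closedBall hq)
    by_cases hpc' : p = c
    · subst hpc'
      obtain ⟨q, ⟨hqfr, hqt⟩, hqc, hlev⟩ := PhaseGeometry.exists_mem_ray hU hk hk' hset
        (lt_min ht hs) (min_le_right t s)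
      have hqs : q ∈ ball p s := ball_subset_ball (min_le_right _ _) hqt
      obtain ⟨t₁, ht₁, -, hflat⟩ := PhaseGeometry.flat_of_mem_ray hU hk hk' hset hqfr hqs hqc hlev
      exact ⟨q, ⟨hqfr, ball_subset_ball (min_le_left _ _) hqt⟩, h0' q hqs, k, t₁, ht₁, hflat⟩
    · rcases PhaseGeometry.level_eq_zero_or_of_mem_frontier hU hset hp hpc with hlev | hlev
      · obtain ⟨t₁, ht₁, -, hflat⟩ := PhaseGeometry.flat_of_mem_ray hU hk hk' hset hp hpc hpc' hlev
        exact ⟨p, ⟨hp, mem_ball_self ht⟩, hp0, k, t₁, ht₁, hflat⟩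
      · have hset' : D.carrier ∩ ball c s = halfPlane k' c ∩ halfPlane k c ∩ ball c s ∨
            D.carrier ∩ ball c s = (halfPlane k' c ∪ halfPlane k c) ∩ ball c s := by
          rcases hset with h | h
          · left; rw [h, inter_comm (halfPlane k c)]
          · right; rw [h, union_comm]
        obtain ⟨t₁, ht₁, -, hflat⟩ := PhaseGeometry.flat_of_mem_ray hU hk.symm
          (fun h => hk' (by rw [h, neg_neg])) hset' hp hpc hpc' hlev
        exact ⟨p, ⟨hp, mem_ball_self ht⟩, hp0, k', t₁, ht₁, hflat⟩

/-- **Boundary values of `im L` exist at flat points of `∂Ω ∖ {a}`.** [folklore] -/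
theorem exists_boundaryValue (D : DobrushinDomain) (Φ : ConformalEquiv D.carrier upperHalfPlaneSet)
    (hΦ0 : Tendsto (fun z => ‖Φ z‖) (𝓝[D.carrier] (D.pt 0)) atTop)
    {L : ℂ → ℂ} (hL : ContinuousOn L D.carrier) (hexp : ∀ z ∈ D.carrier, exp (L z) = deriv Φ z)
    {q : ℂ} (hq0 : q ≠ D.pt 0) {k : Fin 6} {s : ℝ} (hs : 0 < s)
    (hflat : D.carrier ∩ ball q s = halfPlane k q ∩ ball q s) :
    ∃ α : ℝ, Tendsto (fun w => (L w).im) (𝓝[D.carrier] q) (𝓝 α) := by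
  set s' : ℝ := min s (dist q (D.pt 0)) with hs'
  have hs'0 : 0 < s' := lt_min hs (dist_pos.2 hq0)
  have hflat' : D.carrier ∩ ball q s' = halfPlane k q ∩ ball q s' :=
    PhaseGeometry.inter_eq_inter_of_subset_ball hflat (ball_subset_ball (min_le_left _ _))
  have h0 : D.pt 0 ∉ ball q s' := fun h => by
    have := mem_ball'.1 h
    exact not_lt.2 (min_le_right s (dist q (D.pt 0))) this
  obtain ⟨t, α, ht, -, -, hT⟩ := PhaseChart.flatChart D Φ hΦ0 hL hexp (norm_innerNormal k) hs'0 hflat' h0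
  exact ⟨α, hT q (mem_ball_self ht) (by rw [sub_self, zero_mul, zero_re])⟩

/-! ### Registered form -/

/-- **Registered helper `phaseBookkeeping_boundaryPreconnected`** (∀-closed form of
`isPreconnected_frontier_diff_root`; sub-goal of stub `boundaryPhaseBookkeeping`, crux
stmt-CriticalPhenomena-14004, line `polygon-parity-squeeze`): the boundary of a Dobrushin domain
minus the root is preconnected. [folklore] -/
theorem phaseBookkeeping_boundaryPreconnected : ∀ (D : DobrushinDomain), IsPreconnected (frontier D.carrier \ {D.pt 0}) :=
  fun D => isPreconnected_frontier_diff_root D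

end PhaseBook

end Summit.CriticalPhenomena.SAWScalingLimit.Theorems.PolygonParitySqueeze

end
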